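import Mathlib

/-!
# THEOREM XVII — kernel plates (transfer g8, 2026-08-29; census-neutral; nothing here is a rung of
`BlochSeedDiscOne`, HC / HC_CM / HC_AV are NOT proved)

Memo §7r (R.8).  For an inversion-symmetric alphabet `α(a,b)` put `c(x) = x + 1/x`, `U = c(a)^2 - 4`,
`V = c(b)^2 - 4`, moment point `(S,P) = (U+V, UV)`; the flat target is `(S,P) = (12,6)`.
THEOREM XVII (pencil) says every RESONANT alphabet has `c(b) - c(a) ≤ 4/3`.  This file kernel-checks:

* `cdiff_identity`, `det_factorisations` — (i) as ring/field identities; `delta_type_bound` — (ii)'s δ-type bound;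
* `moment_lower_bound` — (iv): `c(b) - c(a) ≤ 4/3` forces `P ≥ S^2/4 - (8/9)(S+8)`;
* `jensen_quadratic` / `no_flat_average` — the region above that convex curve is closed under weighted
  averages and misses the flat target `(12,6)` (value `164/9 > 6` at `S = 12`), for every finite weighted family;
* bounded searches (`native_decide`) for (iii): the two quartics `x^4 ∓ x^2 y^2 + y^4 = □` (resp. `+3`)
  have no solution with `0 < x, y ≤ 150` (`x ≠ y` for the first), and the extremal systems (I), (II) have no
  pairwise-coprime solution with all four gcd-variables `≤ 30`.
The unbounded statements (Mordell, *Diophantine Equations*, ch. 4 eq. (8); the 2-isogeny descents of (R.8))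
are NOT formalised here.
-/

namespace Summit.HodgeConjecture.HodgeConjecture.Cruxes.BlochSeedDiscOne.ResonantBalance

/-- (iv), pointwise: balance `cb - ca ≤ 4/3` (with `ca ≤ cb`; `c(x) ≥ 2` is not even needed) puts the moment point on or above the
convex curve `P = S^2/4 - (8/9)(S+8)`. -/
theorem moment_lower_bound (ca cb : ℝ) (hcb : ca ≤ cb) (hd : cb - ca ≤ 4 / 3) :
    ((ca ^ 2 - 4) + (cb ^ 2 - 4)) ^ 2 / 4 - (8 / 9) * (((ca ^ 2 - 4) + (cb ^ 2 - 4)) + 8)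
      ≤ (ca ^ 2 - 4) * (cb ^ 2 - 4) := by
  have h0 : 0 ≤ cb - ca := sub_nonneg.mpr hcb
  have h1 : (cb - ca) ^ 2 ≤ 16 / 9 := by nlinarith
  have h2 : (ca + cb) ^ 2 ≤ 2 * (ca ^ 2 + cb ^ 2) := by nlinarith [sq_nonneg (ca - cb)]
  have h3 : (cb - ca) ^ 2 * (ca + cb) ^ 2 ≤ 16 / 9 * (ca + cb) ^ 2 :=
    mul_le_mul_of_nonneg_right h1 (sq_nonneg _)
  nlinarith [h2, h3]

/-- The curve's value at the flat abscissa `S = 12` is `164/9 > 6`: the flat target `(12,6)` lies strictly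
below the curve. -/
theorem target_below_curve : (6 : ℝ) < (12 : ℝ) ^ 2 / 4 - (8 / 9) * (12 + 8) := by norm_num

/-- Jensen for the quadratic part: a weighted average of squares dominates the square of the average. -/
theorem jensen_quadratic {n : ℕ} (w S : Fin n → ℝ) (hw : ∀ i, 0 ≤ w i) (hw1 : ∑ i, w i = 1) :
    (∑ i, w i * S i) ^ 2 ≤ ∑ i, w i * S i ^ 2 := by
  set m := ∑ i, w i * S i with hm
  have key : 0 ≤ ∑ i, w i * (S i - m) ^ 2 :=
    Finset.sum_nonneg fun i _ => mul_nonneg (hw i) (sq_nonneg _)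
  have expand : ∑ i, w i * (S i - m) ^ 2 = (∑ i, w i * S i ^ 2) - 2 * m * (∑ i, w i * S i) + m ^ 2 * ∑ i, w i := by
    have : ∀ i, w i * (S i - m) ^ 2 = w i * S i ^ 2 - 2 * m * (w i * S i) + m ^ 2 * w i := fun i => by ring
    simp only [this, Finset.sum_add_distrib, Finset.sum_sub_distrib, Finset.mul_sum]
  rw [expand, hw1, ← hm] at key
  nlinarith [key]

/-- (iv), averaged: NO weighted average of points on or above the curve is the flat target `(12,6)`.
Inputs per point: `P i ≥ S i ^ 2 / 4 - (8/9) (S i + 8)` (from `moment_lower_bound`). -/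
theorem no_flat_average {n : ℕ} (w S P : Fin n → ℝ) (hw : ∀ i, 0 ≤ w i) (hw1 : ∑ i, w i = 1)
    (hP : ∀ i, S i ^ 2 / 4 - (8 / 9) * (S i + 8) ≤ P i) (hS : ∑ i, w i * S i = 12) :
    6 < ∑ i, w i * P i := by
  have hJ := jensen_quadratic w S hw hw1
  have hpt : ∀ i, w i * S i ^ 2 / 4 - 8 / 9 * (w i * S i) - 64 / 9 * w i ≤ w i * P i := by
    intro i
    have h := mul_le_mul_of_nonneg_left (hP i) (hw i)
    nlinarith [h]
  have hsum := Finset.sum_le_sum fun i (_ : i ∈ Finset.univ) => hpt i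
  simp only [Finset.sum_sub_distrib] at hsum
  rw [← Finset.sum_div, ← Finset.mul_sum, ← Finset.mul_sum, hS, hw1] at hsum
  rw [hS] at hJ
  nlinarith [hsum, hJ]

/-! ## (i) the c-difference identity and (ii) the δ-type bound -/

/-- (i), field identity: `c(b) - c(a) = (p'q - pq')(pp' - qq')/(pp'qq')` for `a = p/q`, `b = p'/q'`. -/
theorem cdiff_identity (p q p' q' : ℝ) (hp : p ≠ 0) (hq : q ≠ 0) (hp' : p' ≠ 0) (hq' : q' ≠ 0) :
    (p' / q' + q' / p') - (p / q + q / p) = (p' * q - p * q') * (p * p' - q * q') / (p * p' * q * q') := by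
  field_simp
  ring

/-- (i), the two determinant factorisations in the four-gcd parametrisation
`p = αβρ, q = γδσ, p' = αγρ', q' = βδσ'`: `p'q - pq' = αδ·(γ²ρ'σ - β²ρσ')` and `pp' - qq' = βγ·(α²ρρ' - δ²σσ')`,
so that `c(b) - c(a) = (αδ·n₁)(βγ·n₂)/(pp'qq')` up to sign, and `pp'qq' = (ρσ)(ρ'σ')(αδ)²(βγ)²`. -/
theorem det_factorisations (α β γ δ ρ σ ρ' σ' : ℤ) :
    (α * γ * ρ') * (γ * δ * σ) - (α * β * ρ) * (β * δ * σ') = α * δ * (γ ^ 2 * ρ' * σ - β ^ 2 * ρ * σ') ∧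
    (α * β * ρ) * (α * γ * ρ') - (γ * δ * σ) * (β * δ * σ') = β * γ * (α ^ 2 * ρ * ρ' - δ ^ 2 * σ * σ') ∧
    (α * β * ρ) * (α * γ * ρ') * (γ * δ * σ) * (β * δ * σ') = (ρ * σ) * (ρ' * σ') * (α * δ) ^ 2 * (β * γ) ^ 2 := by
  refine ⟨by ring, by ring, by ring⟩

/-- (ii), δ-type: for positive integers `u < v`, `5 (v - u) ≤ u² + v²`, i.e. `2|u-v|/(u²+v²) ≤ 2/5`
(equality at `(1,2)` and `(1,3)`). -/
theorem delta_type_bound (u v : ℕ) (hu : 1 ≤ u) (huv : u < v) : 5 * (v - u) ≤ u ^ 2 + v ^ 2 := by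
  obtain ⟨d, rfl⟩ : ∃ d, v = u + d := ⟨v - u, by omega⟩
  have hd : 1 ≤ d := by omega
  rw [Nat.add_sub_cancel_left]
  rcases Nat.lt_or_ge d 3 with h | h
  · interval_cases d <;> nlinarith [hu]
  · have h3 : 3 * d ≤ d * d := Nat.mul_le_mul_right d h
    nlinarith [h3, hu]

/-! ## Bounded searches for (iii) -/

/-- `n` is a perfect square (Boolean). -/
def isSq (n : ℕ) : Bool := Nat.sqrt n * Nat.sqrt n == n

/-- no `0 < x, y ≤ B`, `x ≠ y`, with `x^4 - x^2 y^2 + y^4` a square (ℕ subtraction is exact here since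
`x^4 + y^4 ≥ x^2 y^2`). -/
def quarticMinusFree (B : ℕ) : Bool :=
  (List.range B).all fun x' => (List.range B).all fun y' =>
    let x := x' + 1; let y := y' + 1
    (x == y) || !(isSq (x ^ 4 + y ^ 4 - x ^ 2 * y ^ 2))

/-- no `0 < x, y ≤ B` with `x^4 + 3 x^2 y^2 + y^4` a square. -/
def quarticPlus3Free (B : ℕ) : Bool :=
  (List.range B).all fun x' => (List.range B).all fun y' =>
    let x := x' + 1; let y := y' + 1
    !(isSq (x ^ 4 + 3 * x ^ 2 * y ^ 2 + y ^ 4))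

theorem quarticMinus_free_150 : quarticMinusFree 150 = true := by native_decide
theorem quarticPlus3_free_150 : quarticPlus3Free 150 = true := by native_decide

/-- absolute difference on ℕ -/
def adiff (x y : ℕ) : ℕ := if x ≤ y then y - x else x - y

/-- Extremal systems of (R.8)(iii) with `r = r' = 1`: (I) `2αδ = det₁ ∧ 2βγ = det₂`, (II) `αδ = det₁ ∧ 2βγ = det₂`
and its mirror `2αδ = det₁ ∧ βγ = det₂`, where `det₁ ∈ {|β²-γ²|, β²+γ²}`, `det₂ ∈ {|δ²-α²|, δ²+α²}`;
variables positive, pairwise coprime, `β ≠ γ`.  `true` = no solution with all four variables `≤ B`. -/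
def extremalFree (B : ℕ) : Bool :=
  (List.range B).all fun a' => (List.range B).all fun d' => (List.range B).all fun b' => (List.range B).all fun g' =>
    let α := a' + 1; let δ := d' + 1; let β := b' + 1; let γ := g' + 1
    let cop := Nat.gcd α δ == 1 && Nat.gcd α β == 1 && Nat.gcd α γ == 1 && Nat.gcd δ β == 1 && Nat.gcd δ γ == 1 && Nat.gcd β γ == 1
    if !(cop && !(β == γ)) then true else
    let d1s := [adiff (β ^ 2) (γ ^ 2), β ^ 2 + γ ^ 2]
    let d2s := [adiff (δ ^ 2) (α ^ 2), δ ^ 2 + α ^ 2]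
    d1s.all fun d1 => d2s.all fun d2 =>
      !((2 * α * δ == d1 && 2 * β * γ == d2) || (α * δ == d1 && 2 * β * γ == d2) || (2 * α * δ == d1 && β * γ == d2))

theorem extremal_free_30 : extremalFree 30 = true := by native_decide

end Summit.HodgeConjecture.HodgeConjecture.Cruxes.BlochSeedDiscOne.ResonantBalance
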